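import Summits.HodgeConjecture.HodgeConjecture.Theorems.F0P2oLineJacquetReindex               -- ★ (J4) A-p01 (g19): §1 `exists_GL_coe_eq_permMatrix`, `transpose_permFrame_mul_gram_mul_permFrame`; §2 `frameConj_permFrame_localLineInl`
import Literature.NumberTheory.GelbartRogawski1991.LocalSplittingCMGaloisTransportUndoubled     -- ★ `congrW_undoubledSplittings_cmFinLocalFamily_s` (the letter's package IS ★ `localSplittingCM`)
import Literature.NumberTheory.GelbartRogawski1991.LocalSplittingCMGaloisTransport               -- ★ `gram_diagonal_TW`
import Literature.NumberTheory.GelbartRogawski1991.LocalSplittingCMFrameNaturality             -- ★ (FN) (U) `frameOp_toRep_localSplittingCMWith` (B-p08 (g24))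
import Literature.NumberTheory.Automorphic.Liu2021.Def411WeilCarriersIrreducibleOfLemD1         -- ★ `commute_omegaLoc_localCenter` (the Θ-currency of (r1))
import Literature.NumberTheory.Automorphic.Liu2021.LemD1LocalInjectivity                      -- ★ `AreIsomorphicRep.symm`
import HarnessLib

/-!
# Crux `HLiu418` — P5 letter L4-if, ROAD v4 link (E): the θ-package local factor `Θ_e(θ, b)` does not depend on the pair enumeration `e`

F0∕P5, cell `hodgecm-mathlib`, crux item `stmt-HodgeConjecture-24832` (`HLiu418`); A-p12 (g18) on A-p18 (g24)'s ROAD CARD v4 §3 deal (E) «e-INVARIANCE»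
(2026-09-01T01:05:31Z).  PROOF lane (theorems only; no `def`, no instance, no notation, no `sorry`); `--supports stmt-HodgeConjecture-24832`.
HONEST LABEL: HC_CM is proved only modulo the printed citations (the 2 remaining named inputs hLiu418, h413) until rung 0 closes; this file proves NO
letter — it is plumbing for the assembler of the last local letter L4-if `Liu2021.LemD1RankTwoCMLetters.LemD1_4IfAsPrintedNonsplitCM₂` of #74.

THE MATHEMATICS (one paragraph).  The letter quantifies over an arbitrary enumeration `e₁ : Fin 2 × Fin 1 ≃ Fin n'` of the basis of `V ⊗ W` (`W = ⟨b⟩` a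
hermitian line), while the class-move machinery of the road is typed at `Equiv.prodUnique (Fin 2) (Fin 1)`.  Two enumerations `e₁, e₂ : Fin N × Fin 1 ≃ Fin n`
differ by `σ := e₁⁻¹ e₂ ∈ 𝔖_n`; the PERMUTATION FRAME `P_σ ∈ GL_n(F)` (★ (J4) `exists_GL_coe_eq_permMatrix`) is a rational isometry
`P_σᵀ · gram e₁ T_V T_W · P_σ = gram e₂ T_V T_W` (★ `transpose_permFrame_mul_gram_mul_permFrame`) conjugating the first member of the dual pair onto itself,
`P_σ · (k ⊗ 1)_{e₂} · P_σ⁻¹ = (k ⊗ 1)_{e₁}` (★ `frameConj_permFrame_localLineInl`), and fixing the centre (★ `frameConj_localCenter`).  By rational-frame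
naturality of the CM local package (★ (FN) (U) `frameOp_toRep_localSplittingCMWith`, B-p08 (g24): Kudla's rigidity descended through the undoubling) the
metaplectic frame operator `frameOp_{P_σ} : 𝒮(F_vⁿ) ≃ 𝒮(F_vⁿ)`, `f ↦ f ∘ P_σ⁻¹`, intertwines the local Weil representations `ω_{e₂}` and `ω_{e₁}` of the letter's
θ-packages along `g' ↦ P_σ g' P_σ⁻¹`; hence it descends to the central `ξ`-coinvariants (★ `TwistedCoinv.mapEquiv` ∕ `mapEquiv_rep`, the pattern of ★
`RankOneThetaLiftFrameTwist.exists_coinvFrameEquiv`) as a `U(V)(F_v)`-isomorphism `Θ_{e₂}(θ, b) ≅ Θ_{e₁}(θ, b)` of the θ-package local factors in the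
currency of ★ (r1) `areIsomorphicRep_localType₂_iff_quot` — [MoeglinVignerasWaldspurger1987, Chap. 2 II Remarque (3)]: the Weil representation does not
depend on the chosen basis up to the frame operator.

* §1 `areIsomorphicRep_theta_of_frameOp` — GENERIC frame transport of the Θ-currency: any two packages `𝓢₁` at `gram e₁ T_V T_W`, `𝓢₂` at `gram e₂ T_V T_W`,
  any rational frame `P` with `Pᵀ gram e₁ P = gram e₂` whose `frameOp` intertwines `ω₂` with `ω₁` along `frameConj` (`hS`) and whose `frameConj` carries
  `(k ⊗ 1)_{e₂}` to `(k ⊗ 1)_{e₁}` (`hι`), any central character `ξ`: `Θ_{e₂}(𝓢₂, ξ) ≅ Θ_{e₁}(𝓢₁, ξ)`;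
* §2 `areIsomorphicRep_theta_perm` — the same at the permutation frame (`hι` discharged by ★ (J4) §2);
* §3 `frameOp_omegaLoc_cmPackage_perm` — `hS` for the letter's CM packages `congrW … (undoubledSplittings … θ …) …` at `e₂` and `e₁`, RANK-GENERIC
  (`dV : Fin N → L`): ★ `congrW_undoubledSplittings_cmFinLocalFamily_s` ×2 + (U) (target Gram diagonal by ★ `gram_diagonal_TW`);
* §4 HEAD `areIsomorphicRep_theta_cmPackage_of_equiv` — **`Θ_{e₁}(θ, b) ≅ Θ_{e₂}(θ, b)`** for every CM field `L`, real non-zero frame `dV : Fin N → L`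
  (`N ≥ 1`), splitting character `θ`, line `b`, central character `ξ`, finite place `v`, and ANY two enumerations `e₁ e₂ : Fin N × Fin 1 ≃ Fin n'` — no frame
  in the statement.  At `N = 2`, `e₂ := Equiv.prodUnique (Fin 2) (Fin 1)` these are links (i) and (iii) of ROAD v4 §2.

References: [MoeglinVignerasWaldspurger1987] Chap. 2 II Remarque (3); [GelbartRogawski1991] §3.1 Prop. 3.1.1 p. 455, §3.2 p. 457; [Kudla1994] §3 Thm. 3.1;
[Liu2021] App. D §D.1 Steps 1–3 (l. 5217–5221), Lemma D.1 (4) (l. 5235); [PlatonovRapinchuk1994] §2.3.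
-/

set_option autoImplicit false
-- the mandated namespace repeats `HodgeConjecture.HodgeConjecture`, as in every `Theorems/*.lean` of this sub-problem
set_option linter.dupNamespace false

noncomputable section

open NumberField IsDedekindDomain Matrix MeasureTheory
open scoped MatrixGroups Kronecker
open Literature.NumberTheory.Automorphic Literature.NumberTheory.Automorphic.UnitaryGroup
open Literature.NumberTheory.GelbartRogawski1991 Literature.NumberTheory.GelbartRogawski1991.UnitaryDualPair
open Literature.NumberTheory.GelbartRogawski1991.UnitaryDualPair.LocalSplitting Literature.NumberTheory.GelbartRogawski1991.UnitaryDualPair.WeilCoinv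
open Literature.NumberTheory.GelbartRogawski1991.GRConstruction
open Literature.NumberTheory.Automorphic.IdeleClassGroup
open Literature.NumberTheory.Automorphic.Liu2021 Literature.NumberTheory.Automorphic.Liu2021.Def411WeilCarriers
open Literature.NumberTheory.Automorphic.Liu2021.Def411WeilCarriersDoubling
open Literature.RepresentationTheory Literature.RepresentationTheory.HeisenbergGroup Literature.RepresentationTheory.Liu2021
open Literature.RepresentationTheory.TwistedCoinv
open Literature.NumberTheory.GaloisRepresentations Literature.RepresentationTheory.HarrisKudlaSweet1996
open Literature.NumberTheory.Rogawski1990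

namespace Summit.HodgeConjecture.HodgeConjecture.Cruxes.HLiu418.F0P5LemD14IfFrameInvariance

open Summit.HodgeConjecture.HodgeConjecture.Cruxes.H413.F0P2oLineJacquetReindex

/-! ## §1 Generic frame transport of the θ-package local factor `Θ_e(𝓢, ξ) = TwistedCoinv.rep ξ ω_v _ ∘ (k ↦ (k ⊗ 1)_e)` -/

section Generic

variable (F E : Type) [Field F] [NumberField F] [Field E] [NumberField E] [Algebra F E]
  (c : E ≃ₐ[F] E) (N : ℕ) {n : ℕ} (e₁ e₂ : Fin N × Fin 1 ≃ Fin n)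
  (JV : Matrix (Fin N) (Fin N) E) (JW : Matrix (Fin 1) (Fin 1) E) {TV : Matrix (Fin N) (Fin N) F} {TW : Matrix (Fin 1) (Fin 1) F}
  [Algebra.IsQuadraticExtension F E] {δ : E} (hcδ : c δ = -δ) (hδ : δ ≠ 0) {d : F} (hd : δ * δ = algebraMap F E d)
  (hV : TV.IsSymm) (hW : TW.IsSymm) (hJV : JV = TV.map (algebraMap F E)) (hJW : JW = TW.map (algebraMap F E)) (hJW0 : JW 0 0 ≠ 0)
  (v : HeightOneSpectrum (𝓞 F))
  (𝓢₁ : FinLocalSplittings F E c n hcδ hδ hd (UnitaryDualPair.gram F e₁ TV TW) (isSymm_gram F e₁ hV hW) (reindex_kronecker_eq_gram_map F E e₁ hJV hJW))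
  (𝓢₂ : FinLocalSplittings F E c n hcδ hδ hd (UnitaryDualPair.gram F e₂ TV TW) (isSymm_gram F e₂ hV hW) (reindex_kronecker_eq_gram_map F E e₂ hJV hJW))
  (P : GL (Fin n) F)

-- two `TwistedCoinv.rep` currencies and the twelve-argument `mapEquiv_rep`; about 2× the default budget (as ★ `exists_coinvFrameEquiv`)
set_option synthInstance.maxHeartbeats 400000 in
set_option maxHeartbeats 1600000 in
/-- **GENERIC FRAME TRANSPORT OF THE θ-PACKAGE LOCAL FACTOR.**  Let `𝓢₁`, `𝓢₂` be local-splitting packages of `U(gram e₁ T_V T_W ⊗ 1)`,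
`U(gram e₂ T_V T_W ⊗ 1)` and `P ∈ GL_n(F)` a rational frame with `Pᵀ · gram e₁ · P = gram e₂` such that (`hS`) the frame operator `frameOp_P` intertwines the
local Weil representations, `frameOp_P (ω₂(g') f) = ω₁(P g' P⁻¹) (frameOp_P f)`, and (`hι`) `P (k ⊗ 1)_{e₂} P⁻¹ = (k ⊗ 1)_{e₁}` for every `k ∈ U(J_V)(F_v)`.  Then
for every character `ξ` of the centre `U(J_W)(F_v)`, `frameOp_P` descends to a `U(J_V)(F_v)`-isomorphism of the central `ξ`-coinvariants read through
`k ↦ (k ⊗ 1)_e`: **`Θ_{e₂}(𝓢₂, ξ) ≅ Θ_{e₁}(𝓢₁, ξ)`** (★ `TwistedCoinv.mapEquiv` for the intertwiner `frameOp_P`, which fixes the centre by ★ `frameConj_localCenter`;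
equivariance by ★ `mapEquiv_rep`). [cite: MoeglinVignerasWaldspurger1987, Chap. 2 II Remarque (3)] [cite: GelbartRogawski1991, §3.1 Remark p. 457 L4–13] -/
theorem areIsomorphicRep_theta_of_frameOp
    (hP : (P : Matrix (Fin n) (Fin n) F)ᵀ * UnitaryDualPair.gram F e₁ TV TW * (P : Matrix (Fin n) (Fin n) F) = UnitaryDualPair.gram F e₂ TV TW)
    (hS : ∀ (g' : localPi E c n (Matrix.reindex e₂ e₂ (JV ⊗ₖ JW)) v) (f : SchwartzBruhat (Fin n → v.adicCompletion F)),
      FrameTransport.frameOp F v n P (𝓢₂.omegaLoc v g' f) =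
        𝓢₁.omegaLoc v (FrameTransport.frameConj F E c v n (reindex_kronecker_eq_gram_map F E e₁ hJV hJW)
          (reindex_kronecker_eq_gram_map F E e₂ hJV hJW) P hP g') (FrameTransport.frameOp F v n P f))
    (hι : ∀ k : localPi E c N JV v,
      FrameTransport.frameConj F E c v n (reindex_kronecker_eq_gram_map F E e₁ hJV hJW) (reindex_kronecker_eq_gram_map F E e₂ hJV hJW) P hP
          (localLineInl E c N e₂ JV JW v k) = localLineInl E c N e₁ JV JW v k)
    (ξ : localPi E c 1 JW v →* ℂˣ) :
    AreIsomorphicRep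
      (show Representation ℂ (localPi E c N JV v) _ from
        (TwistedCoinv.rep ξ (𝓢₂.omegaLoc v) (commute_omegaLoc_localCenter F E c N e₂ JV JW hcδ hδ hd hV hW hJV hJW hJW0 𝓢₂ v)).comp
          (localLineInl E c N e₂ JV JW v))
      (show Representation ℂ (localPi E c N JV v) _ from
        (TwistedCoinv.rep ξ (𝓢₁.omegaLoc v) (commute_omegaLoc_localCenter F E c N e₁ JV JW hcδ hδ hd hV hW hJV hJW hJW0 𝓢₁ v)).comp
          (localLineInl E c N e₁ JV JW v)) := by
  -- the intertwiner fixes the centre: `ω₁(z·1) (frameOp f) = frameOp (ω₂(z·1) f)`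
  have hT : ∀ (z : localPi E c 1 JW v) (f : SchwartzBruhat (Fin n → v.adicCompletion F)),
      (show Representation ℂ (localPi E c 1 JW v) _ from
          (𝓢₁.omegaLoc v).comp (localCenter E c n (Matrix.reindex e₁ e₁ (JV ⊗ₖ JW)) JW hJW0 v)) z (FrameTransport.frameOp F v n P f) =
        (((1 : localPi E c 1 JW v → ℂˣ) z : ℂˣ) : ℂ) •
          FrameTransport.frameOp F v n P ((show Representation ℂ (localPi E c 1 JW v) _ from
            (𝓢₂.omegaLoc v).comp (localCenter E c n (Matrix.reindex e₂ e₂ (JV ⊗ₖ JW)) JW hJW0 v)) z f) := fun z f => by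
    rw [Pi.one_apply, Units.val_one, one_smul]
    change 𝓢₁.omegaLoc v (localCenter E c n (Matrix.reindex e₁ e₁ (JV ⊗ₖ JW)) JW hJW0 v z) (FrameTransport.frameOp F v n P f) =
      FrameTransport.frameOp F v n P (𝓢₂.omegaLoc v (localCenter E c n (Matrix.reindex e₂ e₂ (JV ⊗ₖ JW)) JW hJW0 v z) f)
    rw [hS, FrameTransport.frameConj_localCenter]
  refine ⟨mapEquiv ((show Representation ℂ (localPi E c 1 JW v) _ from
        (𝓢₂.omegaLoc v).comp (localCenter E c n (Matrix.reindex e₂ e₂ (JV ⊗ₖ JW)) JW hJW0 v))) ξ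
      ((show Representation ℂ (localPi E c 1 JW v) _ from
        (𝓢₁.omegaLoc v).comp (localCenter E c n (Matrix.reindex e₁ e₁ (JV ⊗ₖ JW)) JW hJW0 v))) ξ
      (FrameTransport.frameOp F v n P) 1 hT (fun z => (one_mul _).symm), fun k x => ?_⟩
  have h := mapEquiv_rep ((show Representation ℂ (localPi E c 1 JW v) _ from
        (𝓢₂.omegaLoc v).comp (localCenter E c n (Matrix.reindex e₂ e₂ (JV ⊗ₖ JW)) JW hJW0 v))) ξ
      ((show Representation ℂ (localPi E c 1 JW v) _ from
        (𝓢₁.omegaLoc v).comp (localCenter E c n (Matrix.reindex e₁ e₁ (JV ⊗ₖ JW)) JW hJW0 v))) ξ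
      (𝓢₂.omegaLoc v) (𝓢₁.omegaLoc v)
      (commute_omegaLoc_localCenter F E c N e₂ JV JW hcδ hδ hd hV hW hJV hJW hJW0 𝓢₂ v)
      (commute_omegaLoc_localCenter F E c N e₁ JV JW hcδ hδ hd hV hW hJV hJW hJW0 𝓢₁ v)
      (FrameTransport.frameOp F v n P) 1 hT (fun z => (one_mul _).symm)
      (g := localLineInl E c N e₂ JV JW v k) (g' := localLineInl E c N e₁ JV JW v k) (a := (1 : ℂ))
      (fun f => by rw [one_smul, ← hι k, ← hS]) x
  rw [one_smul] at h
  exact h.symm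

end Generic

/-! ## §2 The permutation frame: `hι` is ★ (J4) `frameConj_permFrame_localLineInl` -/

section Perm

variable (F E : Type) [Field F] [NumberField F] [Field E] [NumberField E] [Algebra F E]
  (c : E ≃ₐ[F] E) (N : ℕ) {n : ℕ} (e₁ e₂ : Fin N × Fin 1 ≃ Fin n)
  (JV : Matrix (Fin N) (Fin N) E) (JW : Matrix (Fin 1) (Fin 1) E) {TV : Matrix (Fin N) (Fin N) F} {TW : Matrix (Fin 1) (Fin 1) F}
  [Algebra.IsQuadraticExtension F E] {δ : E} (hcδ : c δ = -δ) (hδ : δ ≠ 0) {d : F} (hd : δ * δ = algebraMap F E d)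
  (hV : TV.IsSymm) (hW : TW.IsSymm) (hJV : JV = TV.map (algebraMap F E)) (hJW : JW = TW.map (algebraMap F E)) (hJW0 : JW 0 0 ≠ 0)
  (v : HeightOneSpectrum (𝓞 F))
  (𝓢₁ : FinLocalSplittings F E c n hcδ hδ hd (UnitaryDualPair.gram F e₁ TV TW) (isSymm_gram F e₁ hV hW) (reindex_kronecker_eq_gram_map F E e₁ hJV hJW))
  (𝓢₂ : FinLocalSplittings F E c n hcδ hδ hd (UnitaryDualPair.gram F e₂ TV TW) (isSymm_gram F e₂ hV hW) (reindex_kronecker_eq_gram_map F E e₂ hJV hJW))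
  (P : GL (Fin n) F) (hP : (P : Matrix (Fin n) (Fin n) F) = Equiv.Perm.permMatrix F (e₁.symm.trans e₂))

set_option synthInstance.maxHeartbeats 400000 in
set_option maxHeartbeats 1600000 in
/-- **FRAME TRANSPORT AT THE PERMUTATION FRAME `↑P_σ = (e₁⁻¹ e₂).permMatrix`**: if `frameOp_{P_σ}` intertwines `ω₂` with `ω₁` along `frameConj_{P_σ}` (`hS`),
then `Θ_{e₂}(𝓢₂, ξ) ≅ Θ_{e₁}(𝓢₁, ξ)` — §1 with `Pᵀ gram e₁ P = gram e₂` from ★ `transpose_permFrame_mul_gram_mul_permFrame` and `hι` from ★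
`frameConj_permFrame_localLineInl` ((J4), A-p01 (g19)). [cite: MoeglinVignerasWaldspurger1987, Chap. 2 II Remarque (3)] [cite: PlatonovRapinchuk1994, §2.3] -/
theorem areIsomorphicRep_theta_perm
    (hS : ∀ (g' : localPi E c n (Matrix.reindex e₂ e₂ (JV ⊗ₖ JW)) v) (f : SchwartzBruhat (Fin n → v.adicCompletion F)),
      FrameTransport.frameOp F v n P (𝓢₂.omegaLoc v g' f) =
        𝓢₁.omegaLoc v (FrameTransport.frameConj F E c v n (reindex_kronecker_eq_gram_map F E e₁ hJV hJW)
          (reindex_kronecker_eq_gram_map F E e₂ hJV hJW) P (transpose_permFrame_mul_gram_mul_permFrame e₁ e₂ TV TW P hP) g')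
          (FrameTransport.frameOp F v n P f))
    (ξ : localPi E c 1 JW v →* ℂˣ) :
    AreIsomorphicRep
      (show Representation ℂ (localPi E c N JV v) _ from
        (TwistedCoinv.rep ξ (𝓢₂.omegaLoc v) (commute_omegaLoc_localCenter F E c N e₂ JV JW hcδ hδ hd hV hW hJV hJW hJW0 𝓢₂ v)).comp
          (localLineInl E c N e₂ JV JW v))
      (show Representation ℂ (localPi E c N JV v) _ from
        (TwistedCoinv.rep ξ (𝓢₁.omegaLoc v) (commute_omegaLoc_localCenter F E c N e₁ JV JW hcδ hδ hd hV hW hJV hJW hJW0 𝓢₁ v)).comp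
          (localLineInl E c N e₁ JV JW v)) :=
  areIsomorphicRep_theta_of_frameOp F E c N e₁ e₂ JV JW hcδ hδ hd hV hW hJV hJW hJW0 v 𝓢₁ 𝓢₂ P
    (transpose_permFrame_mul_gram_mul_permFrame e₁ e₂ TV TW P hP) hS
    (fun k => frameConj_permFrame_localLineInl E c N e₁ e₂ v hJV TW hJW P hP k) ξ

end Perm

/-! ## §3 The pair side for the letter's CM packages (rank-generic): `frameOp_{P_σ}` intertwines `ω_{e₂}(θ, b)` with `ω_{e₁}(θ, b)` -/

section CMPackage

variable (L : Type) [Field L] [NumberField L] [IsCMField L] (v : HeightOneSpectrum (𝓞 ↥(maximalRealSubfield L))) {N : ℕ} [NeZero N]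
  (dV : Fin N → L) (hdV : ∀ i, IsCMField.complexConj L (dV i) = dV i) (hdV0 : ∀ i, dV i ≠ 0) {n' : ℕ} (e₁ e₂ : Fin N × Fin 1 ≃ Fin n')
  (θ : HeckeCharacter L) (hθ : IsSplittingChar L 1 θ) (b : (↥(maximalRealSubfield L))ˣ)

/-- `0 < m` for `Fin N × Fin 1 ≃ Fin m`, `N ≥ 1`. [folklore] -/
private theorem pos_of_equiv {m : ℕ} (e : Fin N × Fin 1 ≃ Fin m) : 0 < m := Fin.pos (e (0, 0))

set_option synthInstance.maxHeartbeats 400000 in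
set_option maxHeartbeats 4000000 in
/-- **THE LOCAL WEIL REPRESENTATIONS OF THE LETTER'S θ-PACKAGES AT TWO ENUMERATIONS ARE `frameOp_{P_σ}`-INTERTWINED** along `frameConj_{P_σ}`, for the package
`congrW … e … (undoubledSplittings … e … θ …) …` of `U(diag dV ⊗ (b))` at `e := e₂` and `e := e₁` (rank-generic `dV : Fin N → L`, `N ≥ 1`): both packages ARE ★
`localSplittingCM` at the Grams `gram eᵢ (realDiagonal dV) (TW b)` (★ `congrW_undoubledSplittings_cmFinLocalFamily_s`), and (FN) (U) ★ `frameOp_toRep_localSplittingCMWith`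
(B-p08 (g24)) applies at `T₀ := gram e₁ …`, `T₀′ := gram e₂ … = P_σᵀ T₀ P_σ` (diagonal by ★ `gram_diagonal_TW`), Borel σ-algebra and Mathlib's `addHaar` (the Haar data inside ★
`localSplittingCM`). [cite: MoeglinVignerasWaldspurger1987, Chap. 2 II Remarque (3)] [cite: Kudla1994, §3 Thm 3.1] [cite: GelbartRogawski1991, §3.1 Prop. 3.1.1 p. 455 L1–3] -/
theorem frameOp_omegaLoc_cmPackage_perm (P : GL (Fin n') ↥(maximalRealSubfield L))
    (hP : (P : Matrix (Fin n') (Fin n') ↥(maximalRealSubfield L)) = Equiv.Perm.permMatrix (↥(maximalRealSubfield L)) (e₁.symm.trans e₂))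
    (g' : localPi L (IsCMField.complexConj L) n' (Matrix.reindex e₂ e₂ (Matrix.diagonal dV ⊗ₖ JW (↥(maximalRealSubfield L)) L b)) v)
    (f : SchwartzBruhat (Fin n' → v.adicCompletion (↥(maximalRealSubfield L)))) :
    FrameTransport.frameOp (↥(maximalRealSubfield L)) v n' P
        ((congrW L e₂ dV hdV (lineW L (TW (↥(maximalRealSubfield L)) b)) (complexConj_lineW L (TW (↥(maximalRealSubfield L)) b))
            (realDiagonal_lineW L (TW (↥(maximalRealSubfield L)) b)) (diagonal_lineW L (TW (↥(maximalRealSubfield L)) b) (JW_eq (↥(maximalRealSubfield L)) L b))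
            (undoubledSplittings L e₂ dV hdV hdV0 (lineW L (TW (↥(maximalRealSubfield L)) b)) (complexConj_lineW L (TW (↥(maximalRealSubfield L)) b))
              (lineW_ne_zero L (TW (↥(maximalRealSubfield L)) b) (isUnit_det_TW (↥(maximalRealSubfield L)) b)) θ (borelPlaceMeasure L)
              (cmFinLocalFamily L e₂ dV hdV hdV0 (lineW L (TW (↥(maximalRealSubfield L)) b)) (complexConj_lineW L (TW (↥(maximalRealSubfield L)) b))
                (lineW_ne_zero L (TW (↥(maximalRealSubfield L)) b) (isUnit_det_TW (↥(maximalRealSubfield L)) b)) θ hθ (borelPlaceMeasure L)))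
            (isSymm_TW (↥(maximalRealSubfield L)) b) (JW_eq (↥(maximalRealSubfield L)) L b)).omegaLoc v g' f) =
      (congrW L e₁ dV hdV (lineW L (TW (↥(maximalRealSubfield L)) b)) (complexConj_lineW L (TW (↥(maximalRealSubfield L)) b))
          (realDiagonal_lineW L (TW (↥(maximalRealSubfield L)) b)) (diagonal_lineW L (TW (↥(maximalRealSubfield L)) b) (JW_eq (↥(maximalRealSubfield L)) L b))
          (undoubledSplittings L e₁ dV hdV hdV0 (lineW L (TW (↥(maximalRealSubfield L)) b)) (complexConj_lineW L (TW (↥(maximalRealSubfield L)) b))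
            (lineW_ne_zero L (TW (↥(maximalRealSubfield L)) b) (isUnit_det_TW (↥(maximalRealSubfield L)) b)) θ (borelPlaceMeasure L)
            (cmFinLocalFamily L e₁ dV hdV hdV0 (lineW L (TW (↥(maximalRealSubfield L)) b)) (complexConj_lineW L (TW (↥(maximalRealSubfield L)) b))
              (lineW_ne_zero L (TW (↥(maximalRealSubfield L)) b) (isUnit_det_TW (↥(maximalRealSubfield L)) b)) θ hθ (borelPlaceMeasure L)))
          (isSymm_TW (↥(maximalRealSubfield L)) b) (JW_eq (↥(maximalRealSubfield L)) L b)).omegaLoc v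
        (FrameTransport.frameConj (↥(maximalRealSubfield L)) L (IsCMField.complexConj L) v n'
          (reindex_kronecker_eq_gram_map (↥(maximalRealSubfield L)) L e₁ (realDiagonal_map L dV hdV).symm (JW_eq (↥(maximalRealSubfield L)) L b))
          (reindex_kronecker_eq_gram_map (↥(maximalRealSubfield L)) L e₂ (realDiagonal_map L dV hdV).symm (JW_eq (↥(maximalRealSubfield L)) L b))
          P (transpose_permFrame_mul_gram_mul_permFrame e₁ e₂ (realDiagonal L dV hdV) (TW (↥(maximalRealSubfield L)) b) P hP) g')
        (FrameTransport.frameOp (↥(maximalRealSubfield L)) v n' P f) := by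
  dsimp only [FinLocalSplittings.omegaLoc]
  simp only [MonoidHom.comp_apply]
  rw [congrW_undoubledSplittings_cmFinLocalFamily_s L e₂ dV hdV hdV0 _ _ _ θ hθ _ _ (isSymm_TW (↥(maximalRealSubfield L)) b)
      (isUnit_det_TW (↥(maximalRealSubfield L)) b) (JW_eq (↥(maximalRealSubfield L)) L b) v,
    congrW_undoubledSplittings_cmFinLocalFamily_s L e₁ dV hdV hdV0 _ _ _ θ hθ _ _ (isSymm_TW (↥(maximalRealSubfield L)) b)
      (isUnit_det_TW (↥(maximalRealSubfield L)) b) (JW_eq (↥(maximalRealSubfield L)) L b) v]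
  letI : MeasurableSpace (v.adicCompletion ↥(maximalRealSubfield L)) := borel _
  haveI : BorelSpace (v.adicCompletion ↥(maximalRealSubfield L)) := ⟨rfl⟩
  have hU := frameOp_toRep_localSplittingCMWith L v MeasureTheory.Measure.addHaar n' (pos_of_equiv e₂)
    (fun i => (realDiagonal L dV hdV) (e₂.symm i).1 (e₂.symm i).1 * ((b : (↥(maximalRealSubfield L))ˣ) : ↥(maximalRealSubfield L)))
    (by unfold realDiagonal; rw [gram_diagonal_TW]; simp only [Matrix.diagonal_apply_eq])
    (isSymm_gram (↥(maximalRealSubfield L)) e₁ (realDiagonal_isSymm L dV hdV) (isSymm_TW (↥(maximalRealSubfield L)) b))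
    (isUnit_det_gram (↥(maximalRealSubfield L)) e₁ (isUnit_det_realDiagonal L dV hdV hdV0) (isUnit_det_TW (↥(maximalRealSubfield L)) b))
    (isSymm_gram (↥(maximalRealSubfield L)) e₂ (realDiagonal_isSymm L dV hdV) (isSymm_TW (↥(maximalRealSubfield L)) b))
    (isUnit_det_gram (↥(maximalRealSubfield L)) e₂ (isUnit_det_realDiagonal L dV hdV hdV0) (isUnit_det_TW (↥(maximalRealSubfield L)) b))
    P (transpose_permFrame_mul_gram_mul_permFrame e₁ e₂ (realDiagonal L dV hdV) (TW (↥(maximalRealSubfield L)) b) P hP)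
    (reindex_kronecker_eq_gram_map (↥(maximalRealSubfield L)) L e₁ (realDiagonal_map L dV hdV).symm (JW_eq (↥(maximalRealSubfield L)) L b))
    (reindex_kronecker_eq_gram_map (↥(maximalRealSubfield L)) L e₂ (realDiagonal_map L dV hdV).symm (JW_eq (↥(maximalRealSubfield L)) L b)) θ hθ g' f
  simp only [MonoidHom.comp_apply] at hU
  exact hU

/-! ## §4 HEAD: the θ-package local factor of the letter does not depend on the enumeration -/

set_option synthInstance.maxHeartbeats 400000 in
set_option maxHeartbeats 4000000 in
/-- **(E) «e-INVARIANCE» — THE θ-PACKAGE LOCAL FACTOR `Θ_e(θ, b)` OF THE LETTER DOES NOT DEPEND ON THE PAIR ENUMERATION `e`.**  For every CM field `L`,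
real non-zero frame `dV : Fin N → L` (`N ≥ 1`), splitting character `θ`, line `b ∈ L⁺ˣ`, character `ξ` of the centre `U((b))(L⁺_v)`, finite place `v` of `L⁺`,
and ANY two enumerations `e₁ e₂ : Fin N × Fin 1 ≃ Fin n'`: **`Θ_{e₁}(θ, b) ≅ Θ_{e₂}(θ, b)`** as representations of `U(diag dV)(L⁺_v)`, where
`Θ_e(θ, b) := TwistedCoinv.rep ξ (ω_e(θ, b)) _ ∘ (k ↦ (k ⊗ 1)_e)` is the Θ-currency of ★ (r1) `areIsomorphicRep_localType₂_iff_quot` on the letter's package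
`congrW … e … (undoubledSplittings … e … θ …) …`.  No frame in the statement: the permutation frame `P_σ`, `σ := e₂⁻¹ e₁`, is ★ (J4) `exists_GL_coe_eq_permMatrix`;
then §2 at the pair side §3.  At `N = 2`, `e₂ := Equiv.prodUnique (Fin 2) (Fin 1)` this is link (i) (and, by ★ `AreIsomorphicRep.symm`, link (iii)) of ROAD v4 §2
for L4-if. [cite: MoeglinVignerasWaldspurger1987, Chap. 2 II Remarque (3)] [cite: Liu2021, App. D §D.1 Steps 1–3 (l. 5217–5221)] [cite: GelbartRogawski1991, §3.1 Prop. 3.1.1 p. 455] -/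
theorem areIsomorphicRep_theta_cmPackage_of_equiv (ξ : localPi L (IsCMField.complexConj L) 1 (JW (↥(maximalRealSubfield L)) L b) v →* ℂˣ) :
    AreIsomorphicRep
      (show Representation ℂ (localPi L (IsCMField.complexConj L) N (Matrix.diagonal dV) v) _ from
        (TwistedCoinv.rep ξ
          ((congrW L e₁ dV hdV (lineW L (TW (↥(maximalRealSubfield L)) b)) (complexConj_lineW L (TW (↥(maximalRealSubfield L)) b))
            (realDiagonal_lineW L (TW (↥(maximalRealSubfield L)) b)) (diagonal_lineW L (TW (↥(maximalRealSubfield L)) b) (JW_eq (↥(maximalRealSubfield L)) L b))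
            (undoubledSplittings L e₁ dV hdV hdV0 (lineW L (TW (↥(maximalRealSubfield L)) b)) (complexConj_lineW L (TW (↥(maximalRealSubfield L)) b))
              (lineW_ne_zero L (TW (↥(maximalRealSubfield L)) b) (isUnit_det_TW (↥(maximalRealSubfield L)) b)) θ (borelPlaceMeasure L)
              (cmFinLocalFamily L e₁ dV hdV hdV0 (lineW L (TW (↥(maximalRealSubfield L)) b)) (complexConj_lineW L (TW (↥(maximalRealSubfield L)) b))
                (lineW_ne_zero L (TW (↥(maximalRealSubfield L)) b) (isUnit_det_TW (↥(maximalRealSubfield L)) b)) θ hθ (borelPlaceMeasure L)))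
            (isSymm_TW (↥(maximalRealSubfield L)) b) (JW_eq (↥(maximalRealSubfield L)) L b)).omegaLoc v)
          (commute_omegaLoc_localCenter (↥(maximalRealSubfield L)) L (IsCMField.complexConj L) N e₁ (Matrix.diagonal dV) (JW (↥(maximalRealSubfield L)) L b)
            (complexConj_imagUnit L) (imagUnit_ne_zero L) (imagUnit_mul_self L) (realDiagonal_isSymm L dV hdV) (isSymm_TW (↥(maximalRealSubfield L)) b)
            (realDiagonal_map L dV hdV).symm (JW_eq (↥(maximalRealSubfield L)) L b) (JW_apply_ne_zero (↥(maximalRealSubfield L)) L b)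
            (congrW L e₁ dV hdV (lineW L (TW (↥(maximalRealSubfield L)) b)) (complexConj_lineW L (TW (↥(maximalRealSubfield L)) b))
              (realDiagonal_lineW L (TW (↥(maximalRealSubfield L)) b)) (diagonal_lineW L (TW (↥(maximalRealSubfield L)) b) (JW_eq (↥(maximalRealSubfield L)) L b))
              (undoubledSplittings L e₁ dV hdV hdV0 (lineW L (TW (↥(maximalRealSubfield L)) b)) (complexConj_lineW L (TW (↥(maximalRealSubfield L)) b))
                (lineW_ne_zero L (TW (↥(maximalRealSubfield L)) b) (isUnit_det_TW (↥(maximalRealSubfield L)) b)) θ (borelPlaceMeasure L)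
                (cmFinLocalFamily L e₁ dV hdV hdV0 (lineW L (TW (↥(maximalRealSubfield L)) b)) (complexConj_lineW L (TW (↥(maximalRealSubfield L)) b))
                  (lineW_ne_zero L (TW (↥(maximalRealSubfield L)) b) (isUnit_det_TW (↥(maximalRealSubfield L)) b)) θ hθ (borelPlaceMeasure L)))
              (isSymm_TW (↥(maximalRealSubfield L)) b) (JW_eq (↥(maximalRealSubfield L)) L b)) v)).comp
          (localLineInl L (IsCMField.complexConj L) N e₁ (Matrix.diagonal dV) (JW (↥(maximalRealSubfield L)) L b) v))
      (show Representation ℂ (localPi L (IsCMField.complexConj L) N (Matrix.diagonal dV) v) _ from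
        (TwistedCoinv.rep ξ
          ((congrW L e₂ dV hdV (lineW L (TW (↥(maximalRealSubfield L)) b)) (complexConj_lineW L (TW (↥(maximalRealSubfield L)) b))
            (realDiagonal_lineW L (TW (↥(maximalRealSubfield L)) b)) (diagonal_lineW L (TW (↥(maximalRealSubfield L)) b) (JW_eq (↥(maximalRealSubfield L)) L b))
            (undoubledSplittings L e₂ dV hdV hdV0 (lineW L (TW (↥(maximalRealSubfield L)) b)) (complexConj_lineW L (TW (↥(maximalRealSubfield L)) b))
              (lineW_ne_zero L (TW (↥(maximalRealSubfield L)) b) (isUnit_det_TW (↥(maximalRealSubfield L)) b)) θ (borelPlaceMeasure L)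
              (cmFinLocalFamily L e₂ dV hdV hdV0 (lineW L (TW (↥(maximalRealSubfield L)) b)) (complexConj_lineW L (TW (↥(maximalRealSubfield L)) b))
                (lineW_ne_zero L (TW (↥(maximalRealSubfield L)) b) (isUnit_det_TW (↥(maximalRealSubfield L)) b)) θ hθ (borelPlaceMeasure L)))
            (isSymm_TW (↥(maximalRealSubfield L)) b) (JW_eq (↥(maximalRealSubfield L)) L b)).omegaLoc v)
          (commute_omegaLoc_localCenter (↥(maximalRealSubfield L)) L (IsCMField.complexConj L) N e₂ (Matrix.diagonal dV) (JW (↥(maximalRealSubfield L)) L b)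
            (complexConj_imagUnit L) (imagUnit_ne_zero L) (imagUnit_mul_self L) (realDiagonal_isSymm L dV hdV) (isSymm_TW (↥(maximalRealSubfield L)) b)
            (realDiagonal_map L dV hdV).symm (JW_eq (↥(maximalRealSubfield L)) L b) (JW_apply_ne_zero (↥(maximalRealSubfield L)) L b)
            (congrW L e₂ dV hdV (lineW L (TW (↥(maximalRealSubfield L)) b)) (complexConj_lineW L (TW (↥(maximalRealSubfield L)) b))
              (realDiagonal_lineW L (TW (↥(maximalRealSubfield L)) b)) (diagonal_lineW L (TW (↥(maximalRealSubfield L)) b) (JW_eq (↥(maximalRealSubfield L)) L b))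
              (undoubledSplittings L e₂ dV hdV hdV0 (lineW L (TW (↥(maximalRealSubfield L)) b)) (complexConj_lineW L (TW (↥(maximalRealSubfield L)) b))
                (lineW_ne_zero L (TW (↥(maximalRealSubfield L)) b) (isUnit_det_TW (↥(maximalRealSubfield L)) b)) θ (borelPlaceMeasure L)
                (cmFinLocalFamily L e₂ dV hdV hdV0 (lineW L (TW (↥(maximalRealSubfield L)) b)) (complexConj_lineW L (TW (↥(maximalRealSubfield L)) b))
                  (lineW_ne_zero L (TW (↥(maximalRealSubfield L)) b) (isUnit_det_TW (↥(maximalRealSubfield L)) b)) θ hθ (borelPlaceMeasure L)))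
              (isSymm_TW (↥(maximalRealSubfield L)) b) (JW_eq (↥(maximalRealSubfield L)) L b)) v)).comp
          (localLineInl L (IsCMField.complexConj L) N e₂ (Matrix.diagonal dV) (JW (↥(maximalRealSubfield L)) L b) v)) := by
  -- the permutation frame `P_σ`, `σ := e₂⁻¹ e₁` (so that §2 transports FROM `e₁` TO `e₂`)
  obtain ⟨P, hP⟩ := exists_GL_coe_eq_permMatrix (R := ↥(maximalRealSubfield L)) (e₂.symm.trans e₁)
  exact areIsomorphicRep_theta_perm (↥(maximalRealSubfield L)) L (IsCMField.complexConj L) N e₂ e₁ (Matrix.diagonal dV) (JW (↥(maximalRealSubfield L)) L b)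
    (complexConj_imagUnit L) (imagUnit_ne_zero L) (imagUnit_mul_self L) (realDiagonal_isSymm L dV hdV) (isSymm_TW (↥(maximalRealSubfield L)) b)
    (realDiagonal_map L dV hdV).symm (JW_eq (↥(maximalRealSubfield L)) L b) (JW_apply_ne_zero (↥(maximalRealSubfield L)) L b) v _ _ P hP
    (fun g' f => frameOp_omegaLoc_cmPackage_perm L v dV hdV hdV0 e₂ e₁ θ hθ b P hP g' f) ξ

end CMPackage

end Summit.HodgeConjecture.HodgeConjecture.Cruxes.HLiu418.F0P5LemD14IfFrameInvariance

end
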